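import Summits.AtomisticToContinuum.HydrodynamicLimit.Theorems.DensityCap.Negative.MollifiedDensity
import HarnessLib

/-!
# The overshoot event lies in a finite union of fixed-time grid deviation events
# (`stub_capEventSubset`, stub D of the crux line `lipschitz-clock-free-past-cap`,
# `JParityClosure.DensityCap`, stmt-AtomisticToContinuum-13082)

The purely deterministic `η/4`-bookkeeping of the finite-grid reduction of the crux `DensityCap`
to the FIXED-TIME density law of large numbers, at fixed particle number `n` and for ONE
hard-sphere flow `Ψ` on `𝕋³`.

Suppose a GOOD configuration `z` with kinetic energy per particle `n⁻¹ · configEnergy z ≤ K`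
overshoots: `ρ s x + η < ρ̄ʳ(Ψ_s z)(x)` for some `s ∈ [0, t]` and some centre `x`, where
`ρ̄ʳ = mollDensity r` is the `r`-mollified empirical density (cone kernel `cone r`). Pick grid
points `s_k ∈ St` with `|s − s_k| ≤ δt` and `x_l ∈ Sx` with `d(x, x_l) ≤ δx`. Then

* clock (`hclock`, time-Lipschitz of `ρ̄ʳ` along good orbits with constant
  `3/(πr⁴) · √(2 n⁻¹ configEnergy z) ≤ 3/(πr⁴) · √(2K)`) and the mesh condition `hδt₂`:
  `ρ̄ʳ(Ψ_{s_k} z)(x_l) ≥ ρ̄ʳ(Ψ_s z)(x_l) − η/8`;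
* centre-Lipschitz bound (`hlip`) and `hδx₂`: `ρ̄ʳ(Ψ_s z)(x_l) ≥ ρ̄ʳ(Ψ_s z)(x) − η/8`;
* joint modulus of `ρ` (`hmod2`, scales `τ₀ ≥ δt`, `r₀ ≥ δx`): `ρ s x ≥ ρ s_k x_l − η/4`;
* Euler-side cone average (`hmod1`): `∫ cone r y x_l · ρ s_k y dy ≤ ρ s_k x_l + η/4`.

Chaining, `ρ̄ʳ(Ψ_{s_k} z)(x_l) − ∫ cone r y x_l · ρ s_k y dy > η/4`, and the left-hand side is
the deviation of the empirical density field of `Ψ_{s_k} z` tested against the continuous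
kernel `cone r · x_l` (`empiricalDensityField w (cone r · x_l) = mollDensity r w x_l`
definitionally). No sign condition on `η` or `K` is needed.

References: elementary bookkeeping; the vocabulary (`cone`, `mollDensity`) is that of the crux
(`DensityCapNegative`, `Theorems/DensityCap/Negative/MollifiedDensity.lean`), the empirical
density field is `Literature.MathematicalPhysics.KineticTheory.empiricalDensityField`.
-/

noncomputable section

namespace Summit.AtomisticToContinuum.HydrodynamicLimit.Theorems

open MeasureTheory Set
open Literature.MathematicalPhysics.KineticTheory Literature.Analysis.FluidPDE
open Summit.AtomisticToContinuum.HydrodynamicLimit.Theorems.DensityCapNegative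
  (cone mollDensity mollDensity_eq cone_nonneg cone_le)

/-- The empirical density field tested against the cone kernel centred at `x` IS the mollified
empirical density read at `x` (definitional unfolding of
`empiricalDensityField w χ = ∫ χ y.1 ∂(empiricalMeasure w)` and
`mollDensity r w x = ∫ cone r q.1 x ∂(empiricalMeasure w)`). -/
theorem capSub_empiricalDensityField_cone (r : ℝ) {n : ℕ} (w : Config n (Fin 3) T3) (x : T3) :
    empiricalDensityField w (fun y => cone r y x) = mollDensity r w x :=
  rfl

/-- From `|a − b| ≤ c` extract the one-sided bound `b − c ≤ a`. -/
theorem capSub_sub_le_of_abs_sub_le {a b c : ℝ} (h : |a - b| ≤ c) : b - c ≤ a := by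
  have h' := (abs_le.1 h).1
  linarith

/-- Monotonicity of the clock constant: if `n⁻¹ · configEnergy ≤ K` (as reals, `E ≤ K`),
`|Δs| ≤ δt` and `L ≥ 0`, then `L · √(2E) · |Δs| ≤ L · √(2K) · δt`. -/
theorem capSub_clock_mono {L E K a δt : ℝ} (hL : 0 ≤ L) (hEK : E ≤ K) (ha : |a| ≤ δt) :
    L * Real.sqrt (2 * E) * |a| ≤ L * Real.sqrt (2 * K) * δt := by
  have hsq : Real.sqrt (2 * E) ≤ Real.sqrt (2 * K) := Real.sqrt_le_sqrt (by linarith)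
  exact mul_le_mul (mul_le_mul_of_nonneg_left hsq hL) ha (abs_nonneg a)
    (mul_nonneg hL (Real.sqrt_nonneg _))

/-- **The overshoot event lies in a finite union of fixed-time grid deviation events** (stub D of
the line `lipschitz-clock-free-past-cap`). For one hard-sphere flow `Ψ` on `𝕋³`, a density field
`ρ`, a radius `r > 0` and finite nets `St ⊆ [0, t]` (mesh `δt`) and `Sx ⊆ 𝕋³` (mesh `δx` in the
minimal-image distance): if the mollified density is time-Lipschitz along good orbits with
constant `3/(πr⁴)√(2 n⁻¹ configEnergy z)` (`hclock`) and `3/(πr⁴)`-Lipschitz in the centre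
(`hlip`), the cone averages of `ρ` exceed `ρ` by at most `η/4` (`hmod1`), `ρ` has joint modulus
`η/4` at scales `τ₀ ≥ δt`, `r₀ ≥ δx` (`hmod2`), and the meshes satisfy
`3/(πr⁴) δx ≤ η/8`, `3/(πr⁴)√(2K) δt ≤ η/8`, then every GOOD configuration with
`n⁻¹ configEnergy ≤ K` at which `ρ̄ʳ(Ψ_s z)(x) > ρ s x + η` for some `s ∈ [0, t]`, `x ∈ 𝕋³` lies in
one of the finitely many grid events
`{η/4 < |empiricalDensityField (Ψ_{s_k} z) (cone r · x_l) − ∫ cone r y x_l · ρ s_k y dy|}`. -/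
theorem stub_capEventSubset {ε : ℝ} {n : ℕ} (Ψ : HardSphereFlow (Torus.geometry (Fin 3)) ε n)
    (ρ : ℝ → T3 → ℝ) {t η r r₀ τ₀ K δx δt : ℝ} (hr : 0 < r)
    (hclock : ∀ z ∈ Ψ.good, ∀ (s s' : ℝ) (x₀ : T3),
      |mollDensity r (Ψ.flow s' z) x₀ - mollDensity r (Ψ.flow s z) x₀| ≤
        3 / (Real.pi * r ^ 4) * Real.sqrt (2 * ((n : ℝ)⁻¹ * configEnergy z)) * |s' - s|)
    (hlip : ∀ (w : Config n (Fin 3) T3) (x x' : T3),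
      |mollDensity r w x - mollDensity r w x'| ≤ 3 / (Real.pi * r ^ 4) * Torus.euclidDist x x')
    (hmod1 : ∀ s ∈ Icc 0 t, ∀ x : T3, ∫ y, cone r y x * ρ s y ≤ ρ s x + η / 4)
    (hmod2 : ∀ s ∈ Icc 0 t, ∀ s' ∈ Icc 0 t, |s - s'| ≤ τ₀ →
      ∀ x x' : T3, Torus.euclidDist x x' ≤ r₀ → |ρ s x - ρ s' x'| ≤ η / 4)
    (Sx : Finset T3) (hSx : ∀ x : T3, ∃ x' ∈ Sx, Torus.euclidDist x x' ≤ δx)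
    (hδx₁ : δx ≤ r₀) (hδx₂ : 3 / (Real.pi * r ^ 4) * δx ≤ η / 8)
    (St : Finset ℝ) (hSt : ∀ s ∈ St, s ∈ Icc 0 t) (hSt' : ∀ s ∈ Icc 0 t, ∃ s' ∈ St, |s - s'| ≤ δt)
    (hδt₁ : δt ≤ τ₀) (hδt₂ : 3 / (Real.pi * r ^ 4) * Real.sqrt (2 * K) * δt ≤ η / 8) :
    {z | ∃ s ∈ Icc 0 t, ∃ x : T3, ρ s x + η < mollDensity r (Ψ.flow s z) x} ∩ Ψ.good ∩
        {z | (n : ℝ)⁻¹ * configEnergy z ≤ K} ⊆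
      ⋃ s ∈ St, ⋃ x ∈ Sx, {z | η / 4 < |empiricalDensityField (Ψ.flow s z) (fun y => cone r y x) -
        ∫ y, cone r y x * ρ s y|} := by
  rintro z ⟨⟨⟨s, hs, x, hover⟩, hgood⟩, hKz⟩
  replace hKz : (n : ℝ)⁻¹ * configEnergy z ≤ K := hKz
  obtain ⟨sk, hsk, hssk⟩ := hSt' s hs
  obtain ⟨xl, hxl, hxxl⟩ := hSx x
  refine Set.mem_iUnion₂.2 ⟨sk, hsk, Set.mem_iUnion₂.2 ⟨xl, hxl, ?_⟩⟩
  rw [Set.mem_setOf_eq, capSub_empiricalDensityField_cone]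
  -- the Lipschitz constant `L = 3/(π r⁴) > 0`
  have hL : 0 < 3 / (Real.pi * r ^ 4) := div_pos (by norm_num) (mul_pos Real.pi_pos (pow_pos hr 4))
  -- (a) the clock between `s` and the grid time `sk`, read at the grid centre `xl`
  have ha : mollDensity r (Ψ.flow s z) xl - η / 8 ≤ mollDensity r (Ψ.flow sk z) xl := by
    refine capSub_sub_le_of_abs_sub_le ((hclock z hgood s sk xl).trans ?_)
    have hsk' : |sk - s| ≤ δt := by rwa [abs_sub_comm] at hssk
    exact (capSub_clock_mono hL.le hKz hsk').trans hδt₂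
  -- (b) the centre-Lipschitz bound at time `s` between `x` and the grid centre `xl`
  have hb : mollDensity r (Ψ.flow s z) x - η / 8 ≤ mollDensity r (Ψ.flow s z) xl :=
    capSub_sub_le_of_abs_sub_le ((hlip (Ψ.flow s z) xl x).trans
      ((mul_le_mul_of_nonneg_left ((Torus.euclidDist_comm xl x).le.trans hxxl) hL.le).trans hδx₂))
  -- (d) the joint modulus of `ρ` between `(s, x)` and `(sk, xl)`
  have hd : |ρ s x - ρ sk xl| ≤ η / 4 :=
    hmod2 s hs sk (hSt sk hsk) (hssk.trans hδt₁) x xl (hxxl.trans hδx₁)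
  have hd' := (abs_le.1 hd).1
  -- (e) the Euler-side cone average at the grid point
  have he : ∫ y, cone r y xl * ρ sk y ≤ ρ sk xl + η / 4 := hmod1 sk (hSt sk hsk) xl
  -- (f) conclude: the deviation exceeds `η/4`, a fortiori its absolute value does
  refine lt_of_lt_of_le ?_ (le_abs_self _)
  linarith

end Summit.AtomisticToContinuum.HydrodynamicLimit.Theorems

end
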